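import Summits.SmoothPoincare4.SmoothPoincare4.Theorems.CongruenceShadowsShadowApproximationStubFramingZeroLevels

/-!
# Stub `stub_framingZero` of line `epi-class-livingston` for crux `CongruenceShadows.ShadowApproximation`
(item stmt-SmoothPoincare4-14595, route route-SmoothPoincare4-CongruenceShadows) — the genus-3 dictionary

Last of four files (parts A–C: `…StubFramingZeroAbelian/Lattice/Levels`).  Proves the registered stub
**`stub_framingZero`** verbatim: granted (1a) the lattice identity `[S₃,S₃] ≤ Kᵢ(Kⱼ ∩ Kₗ)` for `(3,1)`
group trisections of `{1}` (`stub_latticeIdentity`, landed) and (1b) `Aut F₃ ↠ GL₃(ℤ)`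
(`stub_autFreeGroupRealisesGL`), `ConstantAvatarAt 0` holds: every Waldhausen-normalised (`Pairs`),
shadow-standard (`Shadows`) `(3;1,1,1)` group trisection `K` of the trivial group admits a framing
`φᵢ : S₃ ↠ H 0 i = S₃ ⧸ Nᵢ`, `ker φᵢ = Kᵢ`, whose joint image is the standard one
`Pstd 0 = {(s mod N₀, s mod N₁, s mod N₂)}`.

§1 The standard handlebody groups: `epsH i : H 0 i ≃* F₃` (on the surviving generators `surv i`, part C)
(`quotientEquivFreeGroupErase` reindexed; registered helper `handlebody_free`), `abF : F₃ → ℤ³`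
(exponent sums, literally the map of 1b) with `ker abF ≤ [F₃,F₃]` (via Mathlib's `Abelianization`),
`piH i = abF ∘ epsH i` with `ker πᵢ ≤ γ₂(H 0 i)`, `res i`/`ext0 i` (restriction to / extension from
the surviving coordinates, `ker resᵢ = Cᵢ`), `piH_mk : πᵢ(s mod Nᵢ) = resᵢ(ab s)`, and
`exists_aut_realising` : by 1b every linear automorphism of `ℤ³` is `πᵢ ∘ c = δ ∘ πᵢ` for an
automorphism `c` of `H 0 i`.

§2 Proof of the stub.  (i) `Pairs` gives `αᵢ ∈ Aut S₃` with `αᵢ(Nᵢ) = Kᵢ`; candidates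
`φᵢ = cᵢ ∘ (mod Nᵢ) ∘ αᵢ⁻¹`, `cᵢ ∈ Aut(H 0 i)`, have kernel `Kᵢ` for every `cᵢ`.  (ii) By (1a), for
`K` and for `N = s4Kernels` (`s4Kernels_isGroupTrisection_holds`), both joint images contain
`ker π = γ₂(H₀) × γ₂(H₁) × γ₂(H₂)` (`mem_range_pi_of_commutator`, part C; `π = (πᵢ)ᵢ`), hence are
the preimages of their abelian images (`range_eq_comap_piT`).  (iii) Abelian standardness
(part C, from `Pairs`, `Shadows` at the prime levels `M_p`, the pair quotients and `triple`):
`g ∈ GL₆(ℤ)` with `g(Cᵢ) = L Kᵢ`.  (iv) `Tᵢ = resᵢ ∘ ab(αᵢ)⁻¹ ∘ g : ℤ⁶ ↠ ℤ³` has kernel `Cᵢ`, so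
`Tᵢ = mᵢ ∘ resᵢ` with `mᵢ ∈ GL₃(ℤ)`; taking `cᵢ` with abelianisation `mᵢ⁻¹` makes the abelian image
of the candidate framing `{(resᵢ v)ᵢ : v ∈ ℤ⁶}` = that of the standard avatar (`piH_mk`).
`IsGroupTrisection.free_quotient` of `K` is not needed. [folklore]
-/

-- the prescribed namespace `Summit.<P>.<Sub>.…` duplicates `SmoothPoincare4` (P = Sub)
set_option linter.dupNamespace false
noncomputable section
open Literature.Topology.FourManifolds Multiplicative

namespace Summit.SmoothPoincare4.SmoothPoincare4.Theorems.ShadowApproximation.EpiClassLivingston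

/-! ## §1 The standard handlebody groups -/

/-- `N 0 i` is normal as a subgroup of `SurfaceGroup 3` (`stdKernel_normal 0 i` re-typed at
genus `3 = 3 + 3·0`, for instance search). -/
instance N_zero_normal (i : Fin 3) : Subgroup.Normal (G := SurfaceGroup 3) (N 0 i) :=
  stdKernel_normal 0 i

/-- The killed generators lie in `N 0 i`. [folklore] -/
theorem of_mem_N_zero (i : Fin 3) {x : surfaceGen 3} (hx : x ∈ s4Gens i) :
    (PresentedGroup.of x : SurfaceGroup 3) ∈ N 0 i :=
  of_mem_s4Kernels i hx

/-- `N 0 i` is killed by erasing `s4Gens i`. [folklore] -/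
theorem N_zero_le_ker (i : Fin 3) :
    (N 0 i : Subgroup (SurfaceGroup 3)) ≤ (eraseHom (s4Gens i) (s4Gens_hits i)).ker :=
  s4Kernels_le_ker _ _ i le_rfl

/-- **The standard handlebody group is free on the surviving generators**: `ε_i : H 0 i ≃* F₃`
(`quotientEquivFreeGroupErase`, reindexed by `surv i`). -/
def epsH (i : Fin 3) : H 0 i ≃* FreeGroup (Fin 3) :=
  (quotientEquivFreeGroupErase (s4Gens i) (s4Gens_hits i) (N 0 i)
      (fun _ hx => of_mem_N_zero i hx) (N_zero_le_ker i)).trans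
    (FreeGroup.freeGroupCongr (survEquiv i).symm)

/-- `ε_i` kills the killed generators. [folklore] -/
theorem epsH_mk_of_mem (i : Fin 3) {x : surfaceGen 3} (hx : x ∈ s4Gens i) :
    epsH i (QuotientGroup.mk (PresentedGroup.of x)) = 1 := by
  simp [epsH, quotientEquivFreeGroupErase, eraseGen_of_mem hx]

/-- `ε_i` on a surviving generator. [folklore] -/
theorem epsH_mk_of_not_mem (i : Fin 3) {x : surfaceGen 3} (hx : x ∉ s4Gens i) :
    epsH i (QuotientGroup.mk (PresentedGroup.of x)) = FreeGroup.of (survIdx i x) := by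
  simp [epsH, quotientEquivFreeGroupErase, eraseGen_of_not_mem hx, FreeGroup.map.of, survEquiv]

/-- **Exponent sums** `F₃ → ℤ³` (literally the abelianisation map of `stub_autFreeGroupRealisesGL`). -/
def abF : FreeGroup (Fin 3) →* Multiplicative (Fin 3 → ℤ) :=
  FreeGroup.lift fun k : Fin 3 => Multiplicative.ofAdd (Pi.single k (1 : ℤ) : Fin 3 → ℤ)

/-- `abF` on a generator. [folklore] -/
@[simp] theorem abF_of (k : Fin 3) : abF (FreeGroup.of k) = ofAdd (Pi.single k 1) :=
  FreeGroup.lift_apply_of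

/-- Words with zero exponent sums are products of commutators: `ker abF ≤ [F₃, F₃]`. [folklore] -/
theorem ker_abF_le : abF.ker ≤ commutator (FreeGroup (Fin 3)) := by
  let J : Multiplicative (Fin 3 → ℤ) →* Abelianization (FreeGroup (Fin 3)) :=
    AddMonoidHom.toMultiplicativeLeft (Fintype.linearCombination ℤ
      (fun k : Fin 3 => Additive.ofMul (Abelianization.of (FreeGroup.of k)))).toAddMonoidHom
  have hJ : J.comp abF = Abelianization.of := by
    refine FreeGroup.ext_hom _ _ fun k => ?_
    simp [J, Fintype.linearCombination_apply_single]
  intro x hx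
  rw [← Abelianization.ker_of, MonoidHom.mem_ker, ← hJ, MonoidHom.comp_apply, MonoidHom.mem_ker.1 hx,
    map_one]

/-- **The abelianised handlebody group**: `π_i = abF ∘ ε_i : H 0 i → ℤ³`. -/
def piH (i : Fin 3) : H 0 i →* Multiplicative (Fin 3 → ℤ) := abF.comp (epsH i).toMonoidHom

/-- `ker π_i ≤ [H 0 i, H 0 i]`. [folklore] -/
theorem ker_piH_le (i : Fin 3) : (piH i).ker ≤ commutator (H 0 i) := by
  intro h hh
  rw [MonoidHom.mem_ker, piH, MonoidHom.comp_apply, MulEquiv.coe_toMonoidHom] at hh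
  have h1 : epsH i h ∈ commutator (FreeGroup (Fin 3)) := ker_abF_le hh
  have h2 : (epsH i).symm (epsH i h) ∈ (commutator (FreeGroup (Fin 3))).map (epsH i).symm.toMonoidHom :=
    ⟨_, h1, rfl⟩
  rwa [MulEquiv.symm_apply_apply, commutator_def, Subgroup.map_commutator,
    Subgroup.map_top_of_surjective _ (epsH i).symm.surjective] at h2

/-! ## Coordinates: restriction to and extension from the surviving generators -/

/-- Restriction of `ℤ⁶` to the surviving coordinates of slot `i`. -/
def res (i : Fin 3) : V3 →ₗ[ℤ] (Fin 3 → ℤ) := LinearMap.funLeft ℤ ℤ (surv i)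

/-- `res` coordinatewise. [folklore] -/
@[simp] theorem res_apply (i : Fin 3) (v : V3) (k : Fin 3) : res i v k = v (surv i k) := rfl

/-- `res_i (e_x) = 0` for a killed generator. [folklore] -/
theorem res_e3_of_mem (i : Fin 3) {x : surfaceGen 3} (hx : x ∈ s4Gens i) : res i (e3 x) = 0 := by
  funext k
  exact Pi.single_eq_of_ne (fun h => surv_not_mem i k (by rw [h]; exact hx)) _

/-- `res_i (e_x) = e_{idx x}` for a surviving generator. [folklore] -/
theorem res_e3_of_not_mem (i : Fin 3) {x : surfaceGen 3} (hx : x ∉ s4Gens i) :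
    res i (e3 x) = Pi.single (survIdx i x) 1 := by
  funext k
  rw [res_apply]
  by_cases hk : survIdx i x = k
  · subst hk; rw [surv_survIdx hx]; simp
  · rw [Pi.single_eq_of_ne (Ne.symm hk)]
    exact Pi.single_eq_of_ne (fun h => hk (by rw [← h, survIdx_surv])) _

/-- `res_i v = 0` iff `v` is supported on the killed generators. [folklore] -/
theorem res_eq_zero_iff (i : Fin 3) (v : V3) : res i v = 0 ↔ v ∈ coord ℤ (s4Gens i) := by
  rw [mem_coord, funext_iff]
  exact ⟨fun h x hx => by rw [← surv_survIdx hx]; exact h _, fun h k => h _ (surv_not_mem i k)⟩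

/-- Extension by zero `ℤ³ → ℤ⁶` onto the surviving coordinates of slot `i`. -/
def ext0 (i : Fin 3) : (Fin 3 → ℤ) →ₗ[ℤ] V3 := Fintype.linearCombination ℤ fun k => e3 (surv i k)

/-- `ext0 i b` at a surviving coordinate. [folklore] -/
theorem ext0_apply_surv (i : Fin 3) (b : Fin 3 → ℤ) (k : Fin 3) : ext0 i b (surv i k) = b k := by
  simp only [ext0, Fintype.linearCombination_apply, Finset.sum_apply, Pi.smul_apply, smul_eq_mul]
  rw [Finset.sum_eq_single k]
  · simp
  · intro k' _ hk'
    rw [show e3 (surv i k') (surv i k) = 0 from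
      Pi.single_eq_of_ne (fun h => hk' (surv_inj i _ _ h).symm) _, mul_zero]
  · intro h; exact absurd (Finset.mem_univ k) h

/-- `res ∘ ext0 = id`. [folklore] -/
@[simp] theorem res_ext0 (i : Fin 3) (b : Fin 3 → ℤ) : res i (ext0 i b) = b :=
  funext fun k => by rw [res_apply, ext0_apply_surv]

/-- `v - ext0 (res v)` is supported on the killed generators. [folklore] -/
theorem sub_ext0_res_mem (i : Fin 3) (v : V3) : v - ext0 i (res i v) ∈ coord ℤ (s4Gens i) := by
  refine mem_coord.2 fun x hx => ?_
  obtain ⟨k, rfl⟩ := exists_surv i x hx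
  rw [Pi.sub_apply, ext0_apply_surv, res_apply, sub_self]

/-- **`π_i (s mod Nᵢ) = res_i (ab s)`**: the abelianised standard avatar is the coordinate
projection onto the surviving generators. [folklore] -/
theorem piH_mk (i : Fin 3) (s : SurfaceGroup 3) :
    toAdd (piH i (QuotientGroup.mk s)) = res i (toAdd (ab s)) := by
  let F₁ : SurfaceGroup 3 →* Multiplicative (Fin 3 → ℤ) := (piH i).comp (QuotientGroup.mk' (N 0 i))
  let F₂ : SurfaceGroup 3 →* Multiplicative (Fin 3 → ℤ) :=
    (AddMonoidHom.toMultiplicative (res i).toAddMonoidHom).comp ab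
  have h : F₁ = F₂ := by
    refine PresentedGroup.ext fun x => ?_
    change piH i (QuotientGroup.mk (PresentedGroup.of x)) = ofAdd (res i (toAdd (ab (PresentedGroup.of x))))
    rw [ab_of, toAdd_ofAdd, piH, MonoidHom.comp_apply, MulEquiv.coe_toMonoidHom]
    by_cases hx : x ∈ s4Gens i
    · rw [epsH_mk_of_mem i hx, map_one, res_e3_of_mem i hx]; rfl
    · rw [epsH_mk_of_not_mem i hx, abF_of, res_e3_of_not_mem i hx]
  exact congrArg toAdd (DFunLike.congr_fun h s)

/-- **From `Aut F₃ ↠ GL₃(ℤ)` to the handlebody groups**: granted `stub_autFreeGroupRealisesGL`,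
every linear automorphism `δ` of `ℤ³` is `π_i ∘ c = δ ∘ π_i` for some `c ∈ Aut (H 0 i)`. [folklore] -/
theorem exists_aut_realising
    (hGL : ∀ M : Matrix (Fin 3) (Fin 3) ℤ, IsUnit M.det →
      ∃ θ : FreeGroup (Fin 3) ≃* FreeGroup (Fin 3), ∀ i j : Fin 3,
        Multiplicative.toAdd (FreeGroup.lift
          (fun k : Fin 3 => Multiplicative.ofAdd (Pi.single k (1 : ℤ) : Fin 3 → ℤ))
          (θ (FreeGroup.of i))) j = M i j)
    (i : Fin 3) (δ : (Fin 3 → ℤ) ≃ₗ[ℤ] (Fin 3 → ℤ)) :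
    ∃ c : H 0 i ≃* H 0 i, ∀ h, toAdd (piH i (c h)) = δ (toAdd (piH i h)) := by
  let M : Matrix (Fin 3) (Fin 3) ℤ := fun k j => δ (Pi.single k 1) j
  have hM : M = Matrix.transpose (LinearMap.toMatrix' (δ : (Fin 3 → ℤ) →ₗ[ℤ] (Fin 3 → ℤ))) := by
    ext k j
    rw [Matrix.transpose_apply, LinearMap.toMatrix'_apply, LinearEquiv.coe_coe]
  have hdet : IsUnit M.det := by
    rw [hM, Matrix.det_transpose, LinearMap.det_toMatrix']
    exact LinearEquiv.isUnit_det' δ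
  obtain ⟨θ, hθ⟩ := hGL M hdet
  have habf : ∀ y, toAdd (abF (θ y)) = δ (toAdd (abF y)) := by
    let G₁ : FreeGroup (Fin 3) →* Multiplicative (Fin 3 → ℤ) := abF.comp θ.toMonoidHom
    let G₂ : FreeGroup (Fin 3) →* Multiplicative (Fin 3 → ℤ) :=
      (AddMonoidHom.toMultiplicative (δ : (Fin 3 → ℤ) →ₗ[ℤ] (Fin 3 → ℤ)).toAddMonoidHom).comp abF
    have h : G₁ = G₂ := by
      refine FreeGroup.ext_hom _ _ fun k => ?_
      change abF (θ (FreeGroup.of k)) = ofAdd (δ (toAdd (abF (FreeGroup.of k))))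
      rw [abF_of, toAdd_ofAdd, ← ofAdd_toAdd (abF (θ (FreeGroup.of k)))]
      congr 1
      funext j
      exact hθ k j
    intro y
    exact congrArg toAdd (DFunLike.congr_fun h y)
  refine ⟨((epsH i).trans θ).trans (epsH i).symm, fun h => ?_⟩
  rw [piH, MonoidHom.comp_apply, MonoidHom.comp_apply, MulEquiv.coe_toMonoidHom, MulEquiv.trans_apply,
    MulEquiv.trans_apply, MulEquiv.apply_symm_apply, habf]

/-- The standard handlebody groups are free of rank `3` (registered helper statement). [folklore] -/
theorem handlebody_free : ∀ i : Fin 3, Nonempty (H 0 i ≃* FreeGroup (Fin 3)) := fun i => ⟨epsH i⟩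

/-! ## The joint image is the preimage of its abelian image -/

/-- The abelianisation of the target `Π H 0 i`: `π = (π₀, π₁, π₂)`. -/
def piT : T 0 →* (∀ i : Fin 3, Multiplicative (Fin 3 → ℤ)) :=
  MonoidHom.pi fun i => (piH i).comp (Pi.evalMonoidHom (fun j => H 0 j) i)

/-- `π` coordinatewise. [folklore] -/
@[simp] theorem piT_apply (t : T 0) (i : Fin 3) : piT t i = piH i (t i) := rfl

/-- `ker π ≤ Π γ₂(H 0 i)`. [folklore] -/
theorem mem_commutator_of_mem_ker_piT {t : T 0} (ht : t ∈ piT.ker) (i : Fin 3) :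
    t i ∈ commutator (H 0 i) := by
  refine ker_piH_le i ?_
  rw [MonoidHom.mem_ker, ← piT_apply]
  exact congr_fun (MonoidHom.mem_ker.1 ht) i

/-- A joint image containing `ker π` is the preimage of its abelian image. [folklore] -/
theorem range_eq_comap_piT {f : SurfaceGroup 3 →* T 0} (h : piT.ker ≤ f.range) :
    f.range = (piT.comp f).range.comap piT := by
  rw [← MonoidHom.map_range, Subgroup.comap_map_eq_self h]

/-- **The genus-3 dictionary** (stub `stub_framingZero`, 1c, of the line `epi-class-livingston`):
granted the lattice identity (1a) and `Aut F₃ ↠ GL₃(ℤ)` (1b), every Waldhausen-normalised,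
shadow-standard `(3;1,1,1)` group trisection `K` of the trivial group admits a framing
`φᵢ : S₃ ↠ S₃ ⧸ Nᵢ` with `ker φᵢ = Kᵢ` and the STANDARD joint image `Pstd 0` (proof in the module
docstring, §2). [folklore] -/
theorem stub_framingZero :
    (∀ K : TrisectionKernels 3, IsGroupTrisection 3 1 (PUnit : Type) K →
      ∀ i j l : Fin 3, i ≠ j → j ≠ l → i ≠ l →
        ⁅(⊤ : Subgroup (SurfaceGroup 3)), (⊤ : Subgroup (SurfaceGroup 3))⁆ ≤ K i ⊔ (K j ⊓ K l)) →
    (∀ M : Matrix (Fin 3) (Fin 3) ℤ, IsUnit M.det →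
      ∃ θ : FreeGroup (Fin 3) ≃* FreeGroup (Fin 3), ∀ i j : Fin 3,
        Multiplicative.toAdd (FreeGroup.lift
          (fun k : Fin 3 => Multiplicative.ofAdd (Pi.single k (1 : ℤ) : Fin 3 → ℤ))
          (θ (FreeGroup.of i))) j = M i j) →
    ConstantAvatarAt 0 := by
  intro hlat hGL K hK hP hS
  haveI hKn : ∀ i, (K i).Normal := hK.normal
  -- (i) automorphisms `αᵢ` with `αᵢ(Nᵢ) = Kᵢ`, from `Pairs`
  have hα : ∀ i : Fin 3, ∃ α : SurfaceGroup 3 ≃* SurfaceGroup 3,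
      (s4Kernels i).map α.toMonoidHom = K i := by
    intro i
    obtain ⟨j, hj⟩ := exists_ne i
    obtain ⟨α, h1, -⟩ := hP i j hj.symm
    exact ⟨α, h1⟩
  choose α hα using hα
  -- (iii) abelian standardness
  obtain ⟨g, hg⟩ := exists_adapted_equiv_of_shadows K hK hP hS
  -- (iv) the coordinate changes `cᵢ`
  have key : ∀ i : Fin 3, ∃ c : H 0 i ≃* H 0 i, ∀ s : SurfaceGroup 3,
      toAdd (piH i (c (QuotientGroup.mk ((α i).symm s)))) = res i (g.symm (toAdd (ab s))) := by
    intro i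
    let Ti : V3 →ₗ[ℤ] (Fin 3 → ℤ) :=
      res i ∘ₗ ((abelEquiv (α i)).symm : V3 →ₗ[ℤ] V3) ∘ₗ (g : V3 →ₗ[ℤ] V3)
    have hTi : ∀ v, Ti v = res i ((abelEquiv (α i)).symm (g v)) := fun v => rfl
    -- `ker Tᵢ = Cᵢ`
    have hgL : ∀ v, g v ∈ L (K i) ↔ v ∈ coord ℤ (s4Gens i) := by
      intro v
      rw [← hg i]
      constructor
      · rintro ⟨c, hc, hcv⟩
        rwa [← g.injective hcv]
      · exact fun h => ⟨v, h, rfl⟩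
    have hαL : ∀ w, (abelEquiv (α i)).symm w ∈ coord ℤ (s4Gens i) ↔ w ∈ L (K i) := by
      intro w
      rw [← hα i, L_map_equiv, ← L_s4Kernels]
      constructor
      · intro h
        exact ⟨_, h, (abelEquiv (α i)).apply_symm_apply w⟩
      · rintro ⟨u, hu, rfl⟩
        rwa [LinearEquiv.coe_coe, LinearEquiv.symm_apply_apply]
    have hTker : ∀ v, Ti v = 0 ↔ v ∈ coord ℤ (s4Gens i) := by
      intro v
      rw [hTi, res_eq_zero_iff, hαL, hgL]
    let mf : (Fin 3 → ℤ) →ₗ[ℤ] (Fin 3 → ℤ) := Ti ∘ₗ ext0 i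
    have hTm : ∀ v, Ti v = mf (res i v) := by
      intro v
      have h0 : Ti (v - ext0 i (res i v)) = 0 := (hTker _).2 (sub_ext0_res_mem i v)
      rwa [map_sub, sub_eq_zero] at h0
    have hinj : Function.Injective mf := by
      intro b₁ b₂ h
      rw [← sub_eq_zero, ← map_sub] at h
      have hmem : ext0 i (b₁ - b₂) ∈ coord ℤ (s4Gens i) := (hTker _).1 h
      have : b₁ - b₂ = 0 := by
        rw [← res_ext0 i (b₁ - b₂)]
        exact (res_eq_zero_iff i _).2 hmem
      exact sub_eq_zero.1 this
    have hsurj : Function.Surjective mf := by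
      intro b
      refine ⟨res i (g.symm (abelEquiv (α i) (ext0 i b))), ?_⟩
      rw [← hTm, hTi, LinearEquiv.apply_symm_apply, LinearEquiv.symm_apply_apply, res_ext0]
    let m : (Fin 3 → ℤ) ≃ₗ[ℤ] (Fin 3 → ℤ) := LinearEquiv.ofBijective mf ⟨hinj, hsurj⟩
    obtain ⟨c, hc⟩ := exists_aut_realising hGL i m.symm
    refine ⟨c, fun s => ?_⟩
    rw [hc, piH_mk, show (α i).symm s = (α i).symm.toMonoidHom s from rfl, ← abel_ab,
      ← abelEquiv_symm_apply]
    have h1 : res i ((abelEquiv (α i)).symm (toAdd (ab s))) = Ti (g.symm (toAdd (ab s))) := by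
      rw [hTi, LinearEquiv.apply_symm_apply]
    rw [h1, hTm]
    exact m.symm_apply_apply _
  choose c hc using key
  -- the framing
  let φ : ∀ i : Fin 3, S 0 →* H 0 i := fun i =>
    ((c i).toMonoidHom.comp (QuotientGroup.mk' (N 0 i))).comp (α i).symm.toMonoidHom
  have hφ : ∀ i (s : SurfaceGroup 3), φ i s = c i (QuotientGroup.mk ((α i).symm s)) := fun i s => rfl
  have hφker : ∀ i, (φ i).ker = K i := by
    intro i
    ext s
    rw [MonoidHom.mem_ker, hφ, MulEquiv.map_eq_one_iff, QuotientGroup.eq_one_iff, ← hα i,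
      Subgroup.mem_map_equiv]
    rfl
  have hφsurj : ∀ i, Function.Surjective (φ i) := by
    intro i h
    obtain ⟨s, hs⟩ := QuotientGroup.mk_surjective ((c i).symm h)
    refine ⟨α i s, ?_⟩
    rw [hφ, MulEquiv.symm_apply_apply, hs, MulEquiv.apply_symm_apply]
  refine ⟨φ, hφker, ?_⟩
  -- (ii) both joint images contain `ker π`
  have hstd_surj : ∀ i, Function.Surjective (QuotientGroup.mk' (N 0 i) : SurfaceGroup 3 →* H 0 i) :=
    fun i => QuotientGroup.mk'_surjective _
  have hstd_ker : ∀ i, (QuotientGroup.mk' (N 0 i) : SurfaceGroup 3 →* H 0 i).ker = s4Kernels i :=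
    fun i => QuotientGroup.ker_mk' _
  haveI : ∀ i, (s4Kernels i).Normal := s4Kernels_isGroupTrisection_holds.normal
  have hΓφ : piT.ker ≤ (MonoidHom.pi φ).range := fun t ht =>
    mem_range_pi_of_commutator K (hlat K hK) φ hφsurj hφker t
      (mem_commutator_of_mem_ker_piT ht)
  have hΓstd : piT.ker ≤ (stdPhi 0).range := fun t ht =>
    mem_range_pi_of_commutator s4Kernels (hlat s4Kernels s4Kernels_isGroupTrisection_holds)
      (fun i => QuotientGroup.mk' (N 0 i)) hstd_surj hstd_ker t (mem_commutator_of_mem_ker_piT ht)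
  change (MonoidHom.pi φ).range = (stdPhi 0).range
  rw [range_eq_comap_piT hΓφ, range_eq_comap_piT hΓstd]
  congr 1
  -- the abelian images agree
  ext t
  simp only [MonoidHom.mem_range, MonoidHom.comp_apply]
  constructor
  · rintro ⟨s, rfl⟩
    obtain ⟨s', hs'⟩ := ab_surjective (ofAdd (g.symm (toAdd (ab s))))
    refine ⟨s', funext fun i => ?_⟩
    rw [piT_apply, piT_apply, MonoidHom.pi_apply, hφ, stdPhi_apply]
    apply toAdd.injective
    rw [piH_mk, hc, hs', toAdd_ofAdd]
  · rintro ⟨s, rfl⟩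
    obtain ⟨s', hs'⟩ := ab_surjective (ofAdd (g (toAdd (ab s))))
    refine ⟨s', funext fun i => ?_⟩
    rw [piT_apply, piT_apply, MonoidHom.pi_apply, hφ, stdPhi_apply]
    apply toAdd.injective
    rw [hc, piH_mk, hs', toAdd_ofAdd, LinearEquiv.symm_apply_apply]

end Summit.SmoothPoincare4.SmoothPoincare4.Theorems.ShadowApproximation.EpiClassLivingston
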